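import Literature.Claims.NS.PaiLimsuwan2026

/-!
# D-0090 NS-CLAIMS, claim C136 `PaiLimsuwan2026` — kernel countermodel to the typed locator step

Cell `ns-claims`; refuter `ns-claims-refuter-4` (g3) (typist `ns-claims-typist-6`, referee `ns-claims-ref-4`,
filer `ns-claims-salvage-p4`). The theorem below NEGATES the `def Step7A_L1toL2_abs : Prop` of
`Literature.Claims.NS.PaiLimsuwan2026` (Pai–Limsuwan, Zenodo 10.5281/zenodo.22107318 (2026), Thm 3.1,
display (3.4) p. 3 l. 8–10: «applying Grönwall's inequality together with the energy-conservation
inequality (2.4): 𝒬(t) ≤ 𝒬(0)·exp(C₁∫₀ᵗ‖∇u(s)‖⁴ ds) < ∞ ∀ t») at the PRINT GRAIN typed by the skeleton: the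
only input the print offers for the finiteness of `∫₀ᵗ‖∇u‖⁴_{L²}` is (2.4), a bound on `∫₀ᵗ‖∇u‖²_{L²}`,
i.e. the real-variable inference «`g ≥ 0` continuous on `[0,T)` with `∫₀ᵗ g` bounded ⇒ `∫₀ᵗ g²` bounded».

## `not_Step7A_L1toL2_abs` — witness

`T = 1`, `g(s) = (√(1−s))⁻¹`: continuous and nonnegative on `[0,1)`; by the fundamental theorem of calculus
`∫₀ᵗ g = 2 − 2√(1−t) ≤ 2` (antiderivative `−2√(1−s)`) while `∫₀ᵗ g² = ∫₀ᵗ (1−s)⁻¹ ds = −log(1−t)`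
(antiderivative `−log(1−s)`), which exceeds any `B` at `t = 1 − e^{−(|B|+1)} ∈ [0,1)`. The solution-grain
readings (`Step7_ExpFinite24`, `Step5_Closed33`) are not addressed here.

WHAT THIS IS NOT: not a claim about NS regularity or blow-up; not a claim about any author beyond the typed
locator.
-/

-- The summit's canonical theorem namespace repeats the summit name (single-conjunct summit).
set_option linter.dupNamespace false

noncomputable section

open Set MeasureTheory Real intervalIntegral

namespace Summit.NavierStokesRegularity.NavierStokesRegularity.Theorems.PaiLimsuwan2026

open Literature.Claims.NS.PaiLimsuwan2026

/-- The witness profile `g(s) = (√(1−s))⁻¹` (`= (1−s)^{−1/2}` on `(−∞,1)`, `0` on `[1,∞)`). [folklore] -/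
def g (s : ℝ) : ℝ := (Real.sqrt (1 - s))⁻¹

/-- `g ≥ 0`. [folklore] -/
theorem g_nonneg (s : ℝ) : 0 ≤ g s := by unfold g; positivity

/-- `g` is continuous on `(−∞, 1)`, in particular on `[0, 1)`. [folklore] -/
theorem continuousOn_g : ContinuousOn g (Ico 0 1) := by
  refine ContinuousOn.inv₀ (by fun_prop) fun s hs => ?_
  exact (Real.sqrt_pos.2 (by linarith [hs.2])).ne'

/-- `g² = (1−s)⁻¹` on `(−∞, 1]`. [folklore] -/
theorem g_sq {s : ℝ} (hs : s ≤ 1) : g s ^ 2 = (1 - s)⁻¹ := by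
  unfold g; rw [inv_pow, Real.sq_sqrt (by linarith)]

/-- Antiderivative of `g` below `1`: `d/ds (−2√(1−s)) = (√(1−s))⁻¹`. [folklore] -/
theorem hasDerivAt_G {s : ℝ} (hs : s < 1) : HasDerivAt (fun x => -2 * Real.sqrt (1 - x)) (g s) s := by
  have h1 : (1 : ℝ) - s ≠ 0 := by linarith
  have h := ((Real.hasDerivAt_sqrt h1).comp s ((hasDerivAt_const s (1 : ℝ)).sub (hasDerivAt_id s)))
    |>.const_mul (-2)
  refine h.congr_deriv ?_
  have hpos : 0 < Real.sqrt (1 - s) := Real.sqrt_pos.2 (by linarith)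
  unfold g; field_simp; ring

/-- Antiderivative of `g²` below `1`: `d/ds (−log(1−s)) = (1−s)⁻¹`. [folklore] -/
theorem hasDerivAt_L {s : ℝ} (hs : s < 1) : HasDerivAt (fun x => -Real.log (1 - x)) ((1 - s)⁻¹) s := by
  have h1 : (1 : ℝ) - s ≠ 0 := by linarith
  have h := ((Real.hasDerivAt_log h1).comp s ((hasDerivAt_const s (1 : ℝ)).sub (hasDerivAt_id s))).neg
  refine h.congr_deriv ?_
  simp

/-- `∫₀ᵗ g = 2 − 2√(1−t)` for `0 ≤ t < 1`. [folklore] -/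
theorem integral_g {t : ℝ} (ht0 : 0 ≤ t) (ht1 : t < 1) :
    ∫ s in (0 : ℝ)..t, g s = 2 - 2 * Real.sqrt (1 - t) := by
  have hderiv : ∀ x ∈ uIcc 0 t, HasDerivAt (fun x => -2 * Real.sqrt (1 - x)) (g x) x := by
    intro x hx
    rw [uIcc_of_le ht0] at hx
    exact hasDerivAt_G (by linarith [hx.2])
  have hint : IntervalIntegrable g volume 0 t := by
    refine (continuousOn_g.mono ?_).intervalIntegrable
    rw [uIcc_of_le ht0]; exact Icc_subset_Ico_right ht1
  rw [integral_eq_sub_of_hasDerivAt hderiv hint]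
  simp; ring

/-- `∫₀ᵗ g² = −log(1−t)` for `0 ≤ t < 1`. [folklore] -/
theorem integral_g_sq {t : ℝ} (ht0 : 0 ≤ t) (ht1 : t < 1) :
    ∫ s in (0 : ℝ)..t, g s ^ 2 = -Real.log (1 - t) := by
  have hcongr : ∫ s in (0 : ℝ)..t, g s ^ 2 = ∫ s in (0 : ℝ)..t, (1 - s)⁻¹ := by
    refine integral_congr fun s hs => ?_
    rw [uIcc_of_le ht0] at hs
    exact g_sq (by linarith [hs.2])
  have hderiv : ∀ x ∈ uIcc 0 t, HasDerivAt (fun x => -Real.log (1 - x)) ((1 - x)⁻¹) x := by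
    intro x hx
    rw [uIcc_of_le ht0] at hx
    exact hasDerivAt_L (by linarith [hx.2])
  have hint : IntervalIntegrable (fun s : ℝ => (1 - s)⁻¹) volume 0 t := by
    refine ContinuousOn.intervalIntegrable ?_
    rw [uIcc_of_le ht0]
    exact ContinuousOn.inv₀ (by fun_prop) fun s hs => by linarith [hs.2]
  rw [hcongr, integral_eq_sub_of_hasDerivAt hderiv hint]
  simp

/-- **C136, the locator step at the print grain is false.** `Step7A_L1toL2_abs` — «a nonnegative
continuous `g` on `[0,T)` with `∫₀ᵗ g` bounded has `∫₀ᵗ g²` bounded», the inference from (2.4)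
(`∫₀ᵗ‖∇u‖² ≤ ‖u₀‖²/(2ν)`) to the finiteness of the exponent `∫₀ᵗ‖∇u‖⁴` in (3.4) p. 3 l. 8–10 — fails
for `T = 1`, `g(s) = (1−s)^{−1/2}`: `∫₀ᵗ g ≤ 2` but `∫₀ᵗ g² = −log(1−t)` is unbounded on `[0,1)`.
[cite: PaiLimsuwan2026, Thm 3.1 (3.4) p.3 l.8–10] -/
theorem not_Step7A_L1toL2_abs : ¬ Step7A_L1toL2_abs := by
  intro h
  have hE : ∃ E : ℝ, ∀ t ∈ Ico (0 : ℝ) 1, ∫ s in (0 : ℝ)..t, g s ≤ E := by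
    refine ⟨2, fun t ht => ?_⟩
    rw [integral_g ht.1 ht.2]
    linarith [Real.sqrt_nonneg (1 - t)]
  obtain ⟨B, hB⟩ := h 1 one_pos g continuousOn_g (fun s _ => g_nonneg s) hE
  set t : ℝ := 1 - Real.exp (-(|B| + 1)) with ht_def
  have hexp_pos : 0 < Real.exp (-(|B| + 1)) := Real.exp_pos _
  have hexp_le : Real.exp (-(|B| + 1)) ≤ 1 := by
    rw [Real.exp_le_one_iff]; linarith [abs_nonneg B]
  have ht : t ∈ Ico (0 : ℝ) 1 := ⟨by linarith, by linarith⟩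
  have hval : ∫ s in (0 : ℝ)..t, g s ^ 2 = |B| + 1 := by
    rw [integral_g_sq ht.1 ht.2, ht_def, sub_sub_cancel, Real.log_exp]; ring
  have := hB t ht
  rw [hval] at this
  linarith [le_abs_self B]

end Summit.NavierStokesRegularity.NavierStokesRegularity.Theorems.PaiLimsuwan2026

end
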